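import Summits.AtomisticToContinuum.BoseEinsteinCondensation.Theorems.BECDyadicChainingCoherentAmplitudeMonotone
import Summits.AtomisticToContinuum.BoseEinsteinCondensation.Theorems.BECDyadicChainingDyadicCoherenceDefectLevelIncrement
import Summits.AtomisticToContinuum.BoseEinsteinCondensation.Theorems.BECDyadicChainingBaseCoherentMassFreeBaseAux
import Literature.MathematicalPhysics.QuantumManyBody.BoseGasFreeDirichletBEC
import Literature.MathematicalPhysics.QuantumManyBody.PeriodicBoseGasLocalization
import Literature.MathematicalPhysics.QuantumManyBody.DyadicCoherentFractionLimit
import Mathlib.Analysis.Real.Pi.Bounds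

/-!
# Route `BECDyadicChaining`, crux `BaseCoherentMass` (stmt-AtomisticToContinuum-13193) — the free-gas base

Stub `stub_freeBase` of the registered line of
`Summit.AtomisticToContinuum.BoseEinsteinCondensation.Theses.BECDyadicChaining.BaseCoherentMass`:
GIVEN the one-body sine gap `6‖f‖² ≤ (L/π)²‖∇f‖² + 3|⟨s,f⟩|²` (`s = ∏ₖ √(2/L) sin(πxₖ/L)`, `f ∈ C¹`
vanishing off the box) and the sharp free upper bound `E₀(0,N,L) ≤ 3π²N/L²`, every `δ`-near-minimiser
`Ψ` of the FREE Dirichlet energy (`δ = 3π²N/(100 L²)`) has coherent amplitude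
`A_K = 8^{-K/2} ∑_B √n_B ≥ √N/2` at EVERY dyadic level `K` (`n_B = ⟨φ_B, γ_Ψ φ_B⟩`, `φ_B` the flat modes
`dyMode L K B`).

Proof (Hilbert-space geometry of the Gram vectors `u_φ(Y) = ∫ conj(φ) Ψ(·,Y)`, [LSSY2005, §1.2 (1.17)]):
* `condensation_of_nearMin`: the gap integrated over the slices `x ↦ Ψ(x,Y)` plus the upper bound give
  `1 ≤ 1/100 + ‖u_s‖²` (complete condensation into `s`);
* `slice_error_le`: per slice, `∑_B |⟨φ_B, f⟩ - ⟨φ_B, s⟩⟨s, f⟩|² + |⟨s,f⟩|² ≤ ‖f‖²` (Bessel for the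
  orthonormal flat modes applied to `f - ⟨s,f⟩s`, Pythagoras);
* `base_of_condensation`: Minkowski in `L²(dY)` (`⟨φ_B,s⟩‖u_s‖ ≤ ‖u_B‖ + ‖u_B - ⟨φ_B,s⟩u_s‖`), summed over
  `B`, Cauchy–Schwarz over the `8^K` cells, and `∑_B ⟨φ_B, s⟩ = 8^{K/2}(2√2/π)³ ≥ (7/10)8^{K/2}`:
  `A_K ≥ ((7/10)(99/100) - 1/10)√N ≥ √N/2`.
-/

noncomputable section

namespace Summit.AtomisticToContinuum.BoseEinsteinCondensation.Theorems.BaseCoherentMass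

open MeasureTheory
open scoped ENNReal NNReal ComplexConjugate
open Literature.MathematicalPhysics.QuantumManyBody.BoseGas

/-! ### Measurability of slice pairings -/

/-- `Y ↦ ∫ φ(x) Ψ(x, Y) dx` is measurable for continuous `φ`, `Ψ` (Fubini). [folklore] -/
theorem measurable_integral_mul_vecCons {n : ℕ} {φ : Space → ℂ} (hφ : Continuous φ)
    {Ψ : Config (n + 1) → ℂ} (hΨ : Continuous Ψ) :
    Measurable fun Y : Config n => ∫ x, φ x * Ψ (Matrix.vecCons x Y) := by
  have h : StronglyMeasurable
      (Function.uncurry fun (Y : Config n) (x : Space) => φ x * Ψ (Matrix.vecCons x Y)) :=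
    ((hφ.comp continuous_snd).mul (hΨ.comp (continuous_snd.matrixVecCons continuous_fst))).stronglyMeasurable
  exact (h.integral_prod_right' (ν := volume)).measurable

/-! ### Step 1: complete condensation of free near-minimisers into the sine mode -/

/-- **Condensation of free near-minimisers.** If the one-body gap holds in the form
`6‖f‖² ≤ (L/π)²‖∇f‖² + 3|∫ s f|²` for `C¹` functions vanishing off the box, and `E₀(0, N, L) ≤ 3π²N/L²`,
then every `Ψ` with `energy 0 Ψ ≤ E₀ + 3π²N/(100L²)` has `1 ≤ 1/100 + ∫ |∫ s(x)Ψ(x,Y) dx|² dY`, i.e.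
`⟨s, γ_Ψ s⟩ ≥ (99/100) N` (gap integrated over the slices, `T = N ∫|∇₀Ψ|²` by Bose symmetry).
[cite: LSSY2005, §1.2 (1.17)] -/
theorem condensation_of_nearMin {L : ℝ} {n : ℕ} {s : Space → ℝ} (hsc : Continuous s)
    (hGap : ∀ f : Space → ℂ, ContDiff ℝ 1 f → (∀ x, x ∉ box L → f x = 0) →
      6 * ∫⁻ x, (‖f x‖₊ : ℝ≥0∞) ^ 2 ≤
        ENNReal.ofReal ((L / Real.pi) ^ 2) * (∫⁻ x, gradSqC f x) +
          3 * (‖∫ x, (s x : ℂ) * f x‖₊ : ℝ≥0∞) ^ 2)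
    (hUpper : groundStateEnergy 0 (n + 1) L ≤ ENNReal.ofReal (3 * Real.pi ^ 2 / L ^ 2 * ((n + 1 : ℕ) : ℝ)))
    (Ψ : TrialState (n + 1) L)
    (hΨ : energy 0 Ψ ≤ groundStateEnergy 0 (n + 1) L +
      ENNReal.ofReal (3 * Real.pi ^ 2 / L ^ 2 * (((n + 1 : ℕ) : ℝ) * (1 / 100)))) :
    1 ≤ ENNReal.ofReal (1 / 100) +
      ∫⁻ Y : Config n, (‖∫ x, (s x : ℂ) * Ψ.ψ (Matrix.vecCons x Y)‖₊ : ℝ≥0∞) ^ 2 := by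
  have hL : 0 < L := by
    by_contra hL
    have h0 : ∀ X, Ψ.ψ X = 0 := fun X => Ψ.eq_zero X fun hX => hL ((hX 0 0).1.trans (hX 0 0).2)
    have h1 := Ψ.norm_eq
    simp [h0] at h1
  have hcont : Continuous Ψ.ψ := Ψ.contDiff.continuous
  have hdiff : Differentiable ℝ Ψ.ψ := Ψ.contDiff.differentiable one_ne_zero
  have hmeas : Measurable Ψ.ψ := hcont.measurable
  set T : ℝ≥0∞ := ∫⁻ Y : Config n, (‖∫ x, (s x : ℂ) * Ψ.ψ (Matrix.vecCons x Y)‖₊ : ℝ≥0∞) ^ 2 with hT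
  -- the gap on each slice
  have hY : ∀ Y : Config n, 6 * ∫⁻ x, (‖Ψ.ψ (Matrix.vecCons x Y)‖₊ : ℝ≥0∞) ^ 2 ≤
      ENNReal.ofReal ((L / Real.pi) ^ 2) * (∫⁻ x, gradSqC (fun y => Ψ.ψ (Matrix.vecCons y Y)) x) +
        3 * (‖∫ x, (s x : ℂ) * Ψ.ψ (Matrix.vecCons x Y)‖₊ : ℝ≥0∞) ^ 2 := fun Y =>
    hGap (fun y => Ψ.ψ (Matrix.vecCons y Y)) (contDiff_vecCons_slice Ψ.contDiff Y)
      (fun x hx => Ψ.eq_zero _ fun h => hx (by simpa using h 0))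
  have hint := lintegral_mono (μ := (volume : Measure (Config n))) hY
  have hL1 : ∫⁻ Y : Config n, 6 * ∫⁻ x, (‖Ψ.ψ (Matrix.vecCons x Y)‖₊ : ℝ≥0∞) ^ 2 = 6 := by
    rw [lintegral_const_mul' _ _ (by norm_num), ← lintegral_nnnorm_sq_eq_lintegral_vecCons hmeas,
      Ψ.norm_eq, mul_one]
  have hA : Measurable fun Y : Config n => ∫⁻ x, gradSqC (fun y => Ψ.ψ (Matrix.vecCons y Y)) x :=
    measurable_lintegral_gradSqC_vecCons hdiff
  have hB : Measurable fun Y : Config n =>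
      (‖∫ x, (s x : ℂ) * Ψ.ψ (Matrix.vecCons x Y)‖₊ : ℝ≥0∞) ^ 2 :=
    (measurable_integral_mul_vecCons (Complex.continuous_ofReal.comp hsc)
      hcont).nnnorm.coe_nnreal_ennreal.pow_const 2
  have hR : ∫⁻ Y : Config n, (ENNReal.ofReal ((L / Real.pi) ^ 2) *
      (∫⁻ x, gradSqC (fun y => Ψ.ψ (Matrix.vecCons y Y)) x) +
        3 * (‖∫ x, (s x : ℂ) * Ψ.ψ (Matrix.vecCons x Y)‖₊ : ℝ≥0∞) ^ 2) =
      ENNReal.ofReal ((L / Real.pi) ^ 2) * (∫⁻ X, partialGradSq 0 Ψ.ψ X) + 3 * T := by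
    rw [lintegral_add_left (hA.const_mul _), lintegral_const_mul _ hA, lintegral_const_mul _ hB,
      lintegral_partialGradSq_zero_eq hdiff]
  rw [hL1, hR] at hint
  -- kinetic energy through the first particle, and the energy budget
  have hkin : ((n : ℝ≥0∞) + 1) * ∫⁻ X, partialGradSq 0 Ψ.ψ X = energy 0 Ψ := by
    rw [← lintegral_kineticDensity_eq_mul hdiff Ψ.symm, energy]
    simp
  have hq : (0 : ℝ) ≤ 3 * Real.pi ^ 2 / L ^ 2 := by positivity
  have hLq : (L / Real.pi) ^ 2 * (3 * Real.pi ^ 2 / L ^ 2) = 3 := by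
    have hπ : Real.pi ≠ 0 := Real.pi_pos.ne'
    have hL0 : L ≠ 0 := hL.ne'
    field_simp
  have hN : ENNReal.ofReal ((n + 1 : ℕ) : ℝ) = (n : ℝ≥0∞) + 1 := by
    rw [ENNReal.ofReal_natCast]; push_cast; rfl
  have hE : ENNReal.ofReal ((L / Real.pi) ^ 2) * energy 0 Ψ ≤
      3 * ((n : ℝ≥0∞) + 1) + 3 * (((n : ℝ≥0∞) + 1) * ENNReal.ofReal (1 / 100)) := by
    calc ENNReal.ofReal ((L / Real.pi) ^ 2) * energy 0 Ψ
        ≤ ENNReal.ofReal ((L / Real.pi) ^ 2) * (ENNReal.ofReal (3 * Real.pi ^ 2 / L ^ 2 * ((n + 1 : ℕ) : ℝ)) +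
            ENNReal.ofReal (3 * Real.pi ^ 2 / L ^ 2 * (((n + 1 : ℕ) : ℝ) * (1 / 100)))) :=
          mul_le_mul' le_rfl (hΨ.trans (add_le_add hUpper le_rfl))
      _ = ENNReal.ofReal (3 * ((n + 1 : ℕ) : ℝ)) + ENNReal.ofReal (3 * (((n + 1 : ℕ) : ℝ) * (1 / 100))) := by
          rw [mul_add, ← ENNReal.ofReal_mul (sq_nonneg _), ← ENNReal.ofReal_mul (sq_nonneg _), ← mul_assoc,
            hLq, ← mul_assoc, hLq]
      _ = 3 * ((n : ℝ≥0∞) + 1) + 3 * (((n : ℝ≥0∞) + 1) * ENNReal.ofReal (1 / 100)) := by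
          rw [ENNReal.ofReal_mul (by norm_num : (0 : ℝ) ≤ 3), ENNReal.ofReal_mul (by norm_num : (0 : ℝ) ≤ 3),
            ENNReal.ofReal_mul (Nat.cast_nonneg _), hN, ENNReal.ofReal_ofNat]
  have h6 : 3 * ((n : ℝ≥0∞) + 1) + 3 * (((n : ℝ≥0∞) + 1) * 1) ≤
      3 * ((n : ℝ≥0∞) + 1) + 3 * (((n : ℝ≥0∞) + 1) * (ENNReal.ofReal (1 / 100) + T)) := by
    calc 3 * ((n : ℝ≥0∞) + 1) + 3 * (((n : ℝ≥0∞) + 1) * 1) = ((n : ℝ≥0∞) + 1) * 6 := by ring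
      _ ≤ ((n : ℝ≥0∞) + 1) * (ENNReal.ofReal ((L / Real.pi) ^ 2) * (∫⁻ X, partialGradSq 0 Ψ.ψ X) + 3 * T) :=
          mul_le_mul' le_rfl hint
      _ = ENNReal.ofReal ((L / Real.pi) ^ 2) * (((n : ℝ≥0∞) + 1) * ∫⁻ X, partialGradSq 0 Ψ.ψ X) +
            3 * (((n : ℝ≥0∞) + 1) * T) := by ring
      _ ≤ 3 * ((n : ℝ≥0∞) + 1) + 3 * (((n : ℝ≥0∞) + 1) * ENNReal.ofReal (1 / 100)) +
            3 * (((n : ℝ≥0∞) + 1) * T) := by rw [hkin]; exact add_le_add hE le_rfl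
      _ = 3 * ((n : ℝ≥0∞) + 1) + 3 * (((n : ℝ≥0∞) + 1) * (ENNReal.ofReal (1 / 100) + T)) := by ring
  have hNtop : (n : ℝ≥0∞) + 1 ≠ ⊤ := ENNReal.add_ne_top.2 ⟨ENNReal.natCast_ne_top n, ENNReal.one_ne_top⟩
  have hN0 : (n : ℝ≥0∞) + 1 ≠ 0 := by positivity
  have h3top : 3 * ((n : ℝ≥0∞) + 1) ≠ ⊤ := ENNReal.mul_ne_top (by norm_num) hNtop
  have h7 := (ENNReal.add_le_add_iff_left h3top).1 h6
  have h8 := (ENNReal.mul_le_mul_iff_right (by norm_num) (by norm_num)).1 h7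
  have h9 := (ENNReal.mul_le_mul_iff_right hN0 hNtop).1 h8
  exact h9

/-! ### Step 2: per slice, the flat-mode pairings are those of the condensate up to a Bessel error -/

/-- **Slice estimate.** For `f ∈ C_c` vanishing off the box and a continuous real mode `s` with
`∫_{[0,L)³} s² = 1`: with `c = ∫ s f` and `α_B = (s_K³)^{-1/2} ∫_B s`,
`∑_B |(s_K³)^{-1/2}∫_B f - α_B c|² + |c|² ≤ ∫ |f|²` — the left pairings are `⟨φ_B, f - c s⟩`, Bessel for
the orthonormal flat modes, and Pythagoras `‖f - cs‖² + |c|² = ‖f‖²` on the cube. [folklore] -/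
theorem slice_error_le {L : ℝ} (hL : 0 < L) (K : ℕ) {s : Space → ℝ} (hsc : Continuous s)
    (hs2 : IntegrableOn (fun x => ‖(s x : ℂ)‖ ^ 2) (cell L)) (hs1 : ∫ x in cell L, ‖(s x : ℂ)‖ ^ 2 = 1)
    (hsi : IntegrableOn s (cell L)) {f : Space → ℂ} (hfc : Continuous f) (hfcs : HasCompactSupport f)
    (hf0 : ∀ x, x ∉ box L → f x = 0) :
    (∑ i : Fin 3 → Fin (2 ^ K), ((‖((Real.sqrt ((L / 2 ^ K) ^ 3))⁻¹ : ℂ) * (∫ x in dyCell L K i, f x) -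
        (((Real.sqrt ((L / 2 ^ K) ^ 3))⁻¹ : ℂ) * ∫ x in dyCell L K i, (s x : ℂ)) *
          ∫ x, (s x : ℂ) * f x‖₊ : ℝ≥0∞) ^ 2)) + (‖∫ x, (s x : ℂ) * f x‖₊ : ℝ≥0∞) ^ 2 ≤
      ∫⁻ x, (‖f x‖₊ : ℝ≥0∞) ^ 2 := by
  set a : ℂ := ((Real.sqrt ((L / 2 ^ K) ^ 3))⁻¹ : ℂ) with ha
  set cf : ℂ := ∫ x, (s x : ℂ) * f x with hcf
  have hsC : Continuous fun x => (s x : ℂ) := Complex.continuous_ofReal.comp hsc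
  have hfi : Integrable f := hfc.integrable_of_hasCompactSupport hfcs
  have hf2 : Integrable (fun x => ‖f x‖ ^ 2) :=
    (hfc.norm.pow 2).integrable_of_hasCompactSupport (hfcs.mono fun x hx h0 => hx (by simp [h0]))
  have hsf : Integrable (fun x => (s x : ℂ) * f x) :=
    (hsC.mul hfc).integrable_of_hasCompactSupport (hfcs.mul_left (f := fun x => (s x : ℂ)))
  have hf0' : ∀ x, x ∉ cell L → f x = 0 := fun x hx => hf0 x fun hb => hx (box_subset_cell L hb)
  -- (1) the error coefficients are the pairings with `g = f - cf • s`
  have hg_meas : Measurable fun x => f x - cf * (s x : ℂ) := (hfc.sub (continuous_const.mul hsC)).measurable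
  have hw : ∀ i : Fin 3 → Fin (2 ^ K), a * (∫ x in dyCell L K i, f x) - (a * ∫ x in dyCell L K i, (s x : ℂ)) * cf =
      a * ∫ x in dyCell L K i, (f x - cf * (s x : ℂ)) := by
    intro i
    have hsi' : IntegrableOn (fun x => cf * (s x : ℂ)) (dyCell L K i) :=
      ((hsi.mono_set (dyCell_subset_cell L K i)).ofReal (𝕜 := ℂ)).const_mul cf
    rw [integral_sub hfi.integrableOn hsi', integral_const_mul]
    ring
  -- (2) Bessel on the cells of level `K`
  have hB := sum_nnnorm_flatPairing_sq_le_setLIntegral hL K hg_meas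
  -- (3) Pythagoras on the cube
  have hcf' : ∫ x in cell L, conj (s x : ℂ) * f x = cf := by
    simp_rw [Complex.conj_ofReal]
    exact setIntegral_eq_integral_of_forall_compl_eq_zero fun x hx => by rw [hf0' x hx, mul_zero]
  have hP := lintegral_nnnorm_sub_proj_sq_add (volume.restrict (cell L)) (f := f) (S := fun x => (s x : ℂ))
    hf2.integrableOn hs2 (by simp_rw [Complex.conj_ofReal]; exact hsf.integrableOn) hs1
  rw [hcf'] at hP
  -- (4) assemble
  calc (∑ i : Fin 3 → Fin (2 ^ K), ((‖a * (∫ x in dyCell L K i, f x) -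
        (a * ∫ x in dyCell L K i, (s x : ℂ)) * cf‖₊ : ℝ≥0∞) ^ 2)) + (‖cf‖₊ : ℝ≥0∞) ^ 2
      = (∑ i : Fin 3 → Fin (2 ^ K), ((‖a * ∫ x in dyCell L K i, (f x - cf * (s x : ℂ))‖₊ : ℝ≥0∞) ^ 2)) +
          (‖cf‖₊ : ℝ≥0∞) ^ 2 := by simp only [hw]
    _ ≤ (∫⁻ x in cell L, (‖f x - cf * (s x : ℂ)‖₊ : ℝ≥0∞) ^ 2) + (‖cf‖₊ : ℝ≥0∞) ^ 2 := add_le_add hB le_rfl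
    _ = ∫⁻ x in cell L, (‖f x‖₊ : ℝ≥0∞) ^ 2 := hP
    _ ≤ ∫⁻ x, (‖f x‖₊ : ℝ≥0∞) ^ 2 := setLIntegral_le_lintegral _ _

/-! ### Step 3: the numerical endgame -/

/-- **Endgame arithmetic in `ℝ≥0∞`.** From `1 ≤ 1/100 + T`, `∑R + T ≤ 1`, `κ T^{1/2} ≤ S_V + S_W`,
`S_W ≤ u (∑R)^{1/2}` and `κ ≥ (7/10)u`: `S_V ≥ ((7/10)(99/100) - 1/10) u ≥ u/2`. [folklore] -/
theorem endgame {T SR SV SW : ℝ≥0∞} {κ u : ℝ} (hu : 0 ≤ u) (hG : 1 ≤ ENNReal.ofReal (1 / 100) + T)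
    (hE : SR + T ≤ 1) (hM : ENNReal.ofReal κ * T ^ (1 / 2 : ℝ) ≤ SV + SW)
    (hCS : SW ≤ ENNReal.ofReal u * SR ^ (1 / 2 : ℝ)) (hκ : 7 / 10 * u ≤ κ) :
    ENNReal.ofReal (u / 2) ≤ SV := by
  have hhalf : (0 : ℝ) ≤ 1 / 2 := by norm_num
  have hTtop : T ≠ ⊤ := ne_top_of_le_ne_top ENNReal.one_ne_top (le_add_self.trans hE)
  have h1 : ENNReal.ofReal (1 / 100) + ENNReal.ofReal (99 / 100) = 1 := by
    rw [← ENNReal.ofReal_add (by norm_num) (by norm_num), ← ENNReal.ofReal_one]; norm_num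
  have hT99 : ENNReal.ofReal (99 / 100) ≤ T :=
    (ENNReal.add_le_add_iff_left ENNReal.ofReal_ne_top).1 (h1.symm ▸ hG)
  have hSR : SR ≤ ENNReal.ofReal (1 / 100) := (ENNReal.add_le_add_iff_right hTtop).1 (hE.trans hG)
  have hT12 : ENNReal.ofReal (99 / 100) ≤ T ^ (1 / 2 : ℝ) := by
    refine le_trans ?_ (ENNReal.rpow_le_rpow hT99 hhalf)
    rw [ENNReal.ofReal_rpow_of_nonneg (by norm_num) hhalf]
    exact ENNReal.ofReal_le_ofReal (Real.self_le_rpow_of_le_one (by norm_num) (by norm_num) (by norm_num))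
  have hSR12 : SR ^ (1 / 2 : ℝ) ≤ ENNReal.ofReal (1 / 10) := by
    refine (ENNReal.rpow_le_rpow hSR hhalf).trans_eq ?_
    rw [ENNReal.ofReal_rpow_of_nonneg (by norm_num) hhalf, ← Real.sqrt_eq_rpow,
      show (1 / 100 : ℝ) = (1 / 10) ^ 2 by norm_num, Real.sqrt_sq (by norm_num)]
  have hκ0 : 0 ≤ 7 / 10 * u := by positivity
  have hlow : ENNReal.ofReal (7 / 10 * u * (99 / 100)) ≤ SV + ENNReal.ofReal (u * (1 / 10)) :=
    calc ENNReal.ofReal (7 / 10 * u * (99 / 100)) = ENNReal.ofReal (7 / 10 * u) * ENNReal.ofReal (99 / 100) :=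
          ENNReal.ofReal_mul hκ0
      _ ≤ ENNReal.ofReal κ * T ^ (1 / 2 : ℝ) := mul_le_mul' (ENNReal.ofReal_le_ofReal hκ) hT12
      _ ≤ SV + SW := hM
      _ ≤ SV + ENNReal.ofReal u * ENNReal.ofReal (1 / 10) := add_le_add le_rfl (hCS.trans (mul_le_mul' le_rfl hSR12))
      _ = SV + ENNReal.ofReal (u * (1 / 10)) := by rw [← ENNReal.ofReal_mul hu]
  have hsub : ENNReal.ofReal (7 / 10 * u * (99 / 100) - u * (1 / 10)) ≤ SV := by
    rw [ENNReal.ofReal_sub _ (by positivity)]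
    exact tsub_le_iff_right.2 hlow
  refine le_trans (ENNReal.ofReal_le_ofReal ?_) hsub
  nlinarith

/-! ### Step 4: Gram-vector geometry -/

/-- **The free base from condensation.** For a continuous real mode `s ≥ 0` on `[0,L)³` with
`∫_{[0,L)³} s² = 1` and overlap `(s_K³)^{-1/2}∫_{[0,L)³} s ≥ (7/10)·8^{K/2}` with the flat modes of level `K`,
every trial state with `⟨s, γ_Ψ s⟩ ≥ (99/100)N` (as `1 ≤ 1/100 + ∫|∫ s Ψ(·,Y)|² dY`) has
`√N ≤ 2 · 8^{-K/2} ∑_B √n_B`: Minkowski in `L²(dY)` for `u_B = α_B u_s + w_B`, the slice estimate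
integrated in `Y` (`∑_B ‖w_B‖² ≤ 1/100`), and Cauchy–Schwarz over the `8^K` cells.
[cite: LSSY2005, §1.2 (1.17)] -/
theorem base_of_condensation {L : ℝ} (hL : 0 < L) {n : ℕ} (K : ℕ) {s : Space → ℝ} (hsc : Continuous s)
    (hs2 : IntegrableOn (fun x => ‖(s x : ℂ)‖ ^ 2) (cell L)) (hs1 : ∫ x in cell L, ‖(s x : ℂ)‖ ^ 2 = 1)
    (hsi : IntegrableOn s (cell L)) (hs0 : ∀ x ∈ cell L, 0 ≤ s x)
    (hκ : 7 / 10 * Real.sqrt (8 ^ K) ≤ (Real.sqrt ((L / 2 ^ K) ^ 3))⁻¹ * ∫ x in cell L, s x)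
    (Ψ : TrialState (n + 1) L)
    (hT : 1 ≤ ENNReal.ofReal (1 / 100) +
      ∫⁻ Y : Config n, (‖∫ x, (s x : ℂ) * Ψ.ψ (Matrix.vecCons x Y)‖₊ : ℝ≥0∞) ^ 2) :
    ((n + 1 : ℕ) : ℝ≥0∞) ^ (1 / 2 : ℝ) ≤ 2 * ((8 : ℝ≥0∞) ^ (-(K : ℝ) / 2) *
      ∑ i : Fin 3 → Fin (2 ^ K), (occupation (n + 1) (dyMode L K i) Ψ.ψ) ^ (1 / 2 : ℝ)) := by
  have hcont : Continuous Ψ.ψ := Ψ.contDiff.continuous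
  have hmeas : Measurable Ψ.ψ := hcont.measurable
  have hsC : Continuous fun x => (s x : ℂ) := Complex.continuous_ofReal.comp hsc
  have hhalf : (0 : ℝ) ≤ 1 / 2 := by norm_num
  -- notation
  set a : ℂ := ((Real.sqrt ((L / 2 ^ K) ^ 3))⁻¹ : ℂ) with ha
  set c : Config n → ℂ := fun Y => ∫ x, (s x : ℂ) * Ψ.ψ (Matrix.vecCons x Y) with hc
  set α : (Fin 3 → Fin (2 ^ K)) → ℂ := fun i => a * ∫ x in dyCell L K i, (s x : ℂ) with hα
  set u : (Fin 3 → Fin (2 ^ K)) → Config n → ℂ := fun i Y =>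
    ∫ x, conj (dyMode L K i x) * Ψ.ψ (Matrix.vecCons x Y) with hu
  set w : (Fin 3 → Fin (2 ^ K)) → Config n → ℂ := fun i Y =>
    a * (∫ x in dyCell L K i, Ψ.ψ (Matrix.vecCons x Y)) - α i * c Y with hw
  set T : ℝ≥0∞ := ∫⁻ Y, (‖c Y‖₊ : ℝ≥0∞) ^ 2 with hTdef
  set R : (Fin 3 → Fin (2 ^ K)) → ℝ≥0∞ := fun i => ∫⁻ Y, (‖w i Y‖₊ : ℝ≥0∞) ^ 2 with hR
  set V : (Fin 3 → Fin (2 ^ K)) → ℝ≥0∞ := fun i => ∫⁻ Y, (‖u i Y‖₊ : ℝ≥0∞) ^ 2 with hV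
  have hT' : 1 ≤ ENNReal.ofReal (1 / 100) + T := hT
  -- measurability
  have hc_meas : Measurable c := measurable_integral_mul_vecCons hsC hcont
  have hw_meas : ∀ i, Measurable (w i) := fun i =>
    ((measurable_setIntegral_vecCons hmeas _).const_mul a).sub (hc_meas.const_mul _)
  have hu_eq : ∀ i Y, u i Y = a * ∫ x in dyCell L K i, Ψ.ψ (Matrix.vecCons x Y) := fun i Y =>
    integral_conj_dyMode_mul L K i _
  have hu_meas : ∀ i, AEStronglyMeasurable (u i) volume := fun i => by
    rw [show u i = fun Y => a * ∫ x in dyCell L K i, Ψ.ψ (Matrix.vecCons x Y) from funext (hu_eq i)]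
    exact ((measurable_setIntegral_vecCons hmeas _).const_mul _).aestronglyMeasurable
  -- (E) the slice estimate integrated over `Y`: `∑ R + T ≤ 1`
  have hBY : ∀ Y : Config n, (∑ i, (‖w i Y‖₊ : ℝ≥0∞) ^ 2) + (‖c Y‖₊ : ℝ≥0∞) ^ 2 ≤
      ∫⁻ x, (‖Ψ.ψ (Matrix.vecCons x Y)‖₊ : ℝ≥0∞) ^ 2 := fun Y =>
    slice_error_le hL K hsc hs2 hs1 hsi (hcont.comp (continuous_id.matrixVecCons continuous_const))
      (HasCompactSupport.intro (isCompact_closedBall (0 : Space) (2 * L)) fun x hx =>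
        Ψ.eq_zero _ fun h => hx (box_subset_closedBall L (by simpa using h 0)))
      (fun x hx => Ψ.eq_zero _ fun h => hx (by simpa using h 0))
  have hE : (∑ i, R i) + T ≤ 1 := by
    calc (∑ i, R i) + T = ∫⁻ Y, ((∑ i, (‖w i Y‖₊ : ℝ≥0∞) ^ 2) + (‖c Y‖₊ : ℝ≥0∞) ^ 2) := by
          rw [lintegral_add_right _ (hc_meas.nnnorm.coe_nnreal_ennreal.pow_const 2),
            lintegral_finsetSum _ fun i _ => (hw_meas i).nnnorm.coe_nnreal_ennreal.pow_const 2]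
      _ ≤ ∫⁻ Y, ∫⁻ x, (‖Ψ.ψ (Matrix.vecCons x Y)‖₊ : ℝ≥0∞) ^ 2 := lintegral_mono hBY
      _ = 1 := by rw [← lintegral_nnnorm_sq_eq_lintegral_vecCons hmeas, Ψ.norm_eq]
  -- (M) Minkowski for each cell, summed
  have hM : ∀ i, ‖α i‖ₑ * T ^ (1 / 2 : ℝ) ≤ (V i) ^ (1 / 2 : ℝ) + (R i) ^ (1 / 2 : ℝ) := fun i =>
    enorm_mul_rpow_half_lintegral_le (hu_meas i) (hw_meas i).aestronglyMeasurable (α i) fun Y => by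
      rw [hu_eq]; simp only [hw]; ring
  have hMsum : (∑ i, ‖α i‖ₑ) * T ^ (1 / 2 : ℝ) ≤ (∑ i, (V i) ^ (1 / 2 : ℝ)) + ∑ i, (R i) ^ (1 / 2 : ℝ) := by
    rw [Finset.sum_mul, ← Finset.sum_add_distrib]
    exact Finset.sum_le_sum fun i _ => hM i
  -- the overlap constant `∑ ‖α i‖ = (s_K³)^{-1/2} ∫_{[0,L)³} s`
  have hI0 : ∀ i, 0 ≤ ∫ x in dyCell L K i, s x := fun i =>
    setIntegral_nonneg (measurableSet_dyCell L K i) fun x hx => hs0 x (dyCell_subset_cell L K i hx)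
  have hα_norm : ∀ i, ‖α i‖ₑ = ENNReal.ofReal ((Real.sqrt ((L / 2 ^ K) ^ 3))⁻¹ * ∫ x in dyCell L K i, s x) := by
    intro i
    rw [← ofReal_norm]
    congr 1
    simp only [hα, ha]
    rw [integral_complex_ofReal, norm_mul, norm_inv, Complex.norm_real, Complex.norm_real,
      Real.norm_of_nonneg (Real.sqrt_nonneg _), Real.norm_of_nonneg (hI0 i)]
  have hU : ∫ x in cell L, s x = ∑ i, ∫ x in dyCell L K i, s x := by
    rw [← integral_iUnion_fintype (fun i => measurableSet_dyCell L K i) (pairwise_disjoint_dyCell L K)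
      (fun i => hsi.mono_set (dyCell_subset_cell L K i)), iUnion_dyCell]
    rfl
  have hsumα : ∑ i, ‖α i‖ₑ = ENNReal.ofReal ((Real.sqrt ((L / 2 ^ K) ^ 3))⁻¹ * ∫ x in cell L, s x) := by
    simp only [hα_norm]
    rw [← ENNReal.ofReal_sum_of_nonneg fun i _ => mul_nonneg (inv_nonneg.2 (Real.sqrt_nonneg _)) (hI0 i),
      ← Finset.mul_sum, hU]
  rw [hsumα] at hMsum
  -- (CS) Cauchy–Schwarz over the `8^K` cells
  set ur : ℝ := Real.sqrt (8 ^ K) with hur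
  have hur0 : 0 < ur := Real.sqrt_pos.2 (by positivity)
  have hcard : (Fintype.card (Fin 3 → Fin (2 ^ K)) : ℝ≥0∞) ^ (1 / 2 : ℝ) = ENNReal.ofReal ur := by
    rw [card_dyIndex, show ((8 ^ K : ℕ) : ℝ≥0∞) = ENNReal.ofReal ((8 : ℝ) ^ K) by
      rw [← ENNReal.ofReal_natCast]; push_cast; rfl,
      ENNReal.ofReal_rpow_of_nonneg (by positivity) hhalf, hur, Real.sqrt_eq_rpow]
  have hCS : ∑ i, (R i) ^ (1 / 2 : ℝ) ≤ ENNReal.ofReal ur * (∑ i, R i) ^ (1 / 2 : ℝ) := by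
    rw [← hcard]
    exact Summit.AtomisticToContinuum.BoseEinsteinCondensation.Cruxes.DyadicCoherenceDefect.Birth.LevelIncrement.sum_rpow_half_le R
  -- endgame
  have hSV : ENNReal.ofReal (ur / 2) ≤ ∑ i, (V i) ^ (1 / 2 : ℝ) := endgame hur0.le hT' hE hMsum hCS hκ
  -- conclusion: `√N = √N · 1 ≤ √N · 2 · 8^{-K/2} · ∑ √V_i`
  have hocc : ∀ i, (occupation (n + 1) (dyMode L K i) Ψ.ψ) ^ (1 / 2 : ℝ) =
      ((n : ℝ≥0∞) + 1) ^ (1 / 2 : ℝ) * (V i) ^ (1 / 2 : ℝ) := fun i => by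
    rw [← ENNReal.mul_rpow_of_nonneg _ _ hhalf]; rfl
  have h8nn : (0 : ℝ) ≤ 8 := by norm_num
  have h8 : (8 : ℝ≥0∞) ^ (-(K : ℝ) / 2) = ENNReal.ofReal ur⁻¹ := by
    rw [show (8 : ℝ≥0∞) = ENNReal.ofReal 8 by norm_num, ENNReal.ofReal_rpow_of_pos (by norm_num : (0 : ℝ) < 8)]
    congr 1
    rw [neg_div, Real.rpow_neg h8nn, show (K : ℝ) / 2 = (K : ℝ) * (1 / 2) by ring, hur,
      Real.sqrt_eq_rpow, ← Real.rpow_natCast, ← Real.rpow_mul h8nn]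
  have hone : 2 * (ENNReal.ofReal ur⁻¹ * ENNReal.ofReal (ur / 2)) = 1 := by
    rw [← ENNReal.ofReal_mul (inv_nonneg.2 hur0.le), show (2 : ℝ≥0∞) = ENNReal.ofReal 2 by norm_num,
      ← ENNReal.ofReal_mul (by norm_num : (0 : ℝ) ≤ 2), ← ENNReal.ofReal_one]
    congr 1
    field_simp
  simp only [hocc]
  rw [← Finset.mul_sum, h8, Nat.cast_succ]
  calc ((n : ℝ≥0∞) + 1) ^ (1 / 2 : ℝ) = ((n : ℝ≥0∞) + 1) ^ (1 / 2 : ℝ) * (2 * (ENNReal.ofReal ur⁻¹ * ENNReal.ofReal (ur / 2))) := by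
        rw [hone, mul_one]
    _ = 2 * (ENNReal.ofReal ur⁻¹ * (((n : ℝ≥0∞) + 1) ^ (1 / 2 : ℝ) * ENNReal.ofReal (ur / 2))) := by ring
    _ ≤ 2 * (ENNReal.ofReal ur⁻¹ * (((n : ℝ≥0∞) + 1) ^ (1 / 2 : ℝ) * ∑ i, (V i) ^ (1 / 2 : ℝ))) := by
        gcongr

/-! ### The registered stub -/

/-- **Stub `stub_freeBase` — the free-gas base, uniformly in the level.** Given the sine gap and the sharp
free upper bound: for `L > 0`, `N ≥ 1` there is `δ > 0` (`δ = 3π²N/(100L²)`) such that every `δ`-near-minimiser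
`Ψ` of the FREE Dirichlet energy has `√N ≤ 2 A_K(Ψ)` at EVERY level `K`: complete condensation into
`s = ∏ √(2/L) sin(πxₖ/L)` (`⟨s,γ_Ψ s⟩ ≥ 0.99N`), then `A_K ≥ (2√2/π)³√n₀ - √(N - n₀) ≥ √N/2` by the
Gram-vector triangle inequality, Bessel for the flat modes and `∑_B ⟨s, φ_B⟩ = 8^{K/2}(2√2/π)³`.
[cite: LSSY2005, §1.2 (1.17)] -/
theorem stub_freeBase :
    (∀ (L : ℝ), 0 < L → ∀ f : Space → ℂ, ContDiff ℝ 1 f →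
      (∀ x, x ∉ box L → f x = 0) →
      6 * ∫⁻ x, (‖f x‖₊ : ℝ≥0∞) ^ 2 ≤
        ENNReal.ofReal ((L / Real.pi) ^ 2) * (∫⁻ x, gradSqC f x) +
          3 * (‖∫ x, ((∏ k : Fin 3, (Real.sqrt (2 / L) * Real.sin (Real.pi * x k / L)) : ℝ) : ℂ) *
            f x‖₊ : ℝ≥0∞) ^ 2) →
    (∀ (L : ℝ), 0 < L → ∀ N : ℕ,
      groundStateEnergy 0 N L ≤ ENNReal.ofReal (3 * Real.pi ^ 2 / L ^ 2 * N)) →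
    ∀ (N : ℕ) (L : ℝ), 0 < L → 0 < N →
      ∃ δ : ℝ≥0∞, 0 < δ ∧ ∀ Ψ : TrialState N L,
        energy 0 Ψ ≤ groundStateEnergy 0 N L + δ →
        ∀ K : ℕ, (N : ℝ≥0∞) ^ (1 / 2 : ℝ) ≤
          2 * ((8 : ℝ≥0∞) ^ (-(K : ℝ) / 2) *
            ∑ i : Fin 3 → Fin (2 ^ K), (occupation N (dyMode L K i) Ψ.ψ) ^ (1 / 2 : ℝ)) := by
  intro hGap hUpper N L hL hN
  obtain ⟨n, rfl⟩ : ∃ n, N = n + 1 := ⟨N - 1, by omega⟩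
  have hNpos : (0 : ℝ) < ((n + 1 : ℕ) : ℝ) := by positivity
  refine ⟨ENNReal.ofReal (3 * Real.pi ^ 2 / L ^ 2 * (((n + 1 : ℕ) : ℝ) * (1 / 100))),
    ENNReal.ofReal_pos.2 (by positivity), fun Ψ hΨ K => ?_⟩
  have hT := condensation_of_nearMin
    (s := fun x : Space => ∏ k : Fin 3, (Real.sqrt (2 / L) * Real.sin (Real.pi * x k / L)))
    (by fun_prop) (hGap L hL) (hUpper L hL (n + 1)) Ψ hΨ
  exact base_of_condensation hL K (by fun_prop) (integrableOn_norm_sineMode_sq_cell L)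
    (setIntegral_cell_norm_sineMode_sq hL) (integrableOn_sineMode_cell L)
    (fun x hx => sineMode_nonneg_of_mem_cell hL hx)
    (by rw [setIntegral_cell_sineMode hL]; exact sineMode_overlap_ge hL K) Ψ hT

end Summit.AtomisticToContinuum.BoseEinsteinCondensation.Theorems.BaseCoherentMass

end
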